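import Literature.AlgebraicGeometry.Motives.HodgeStructureLefschetzGroupQuaternionBlocks
import Literature.AlgebraicGeometry.Motives.HodgeStructureEndActionCentralBlocks
import Literature.AlgebraicGeometry.Motives.HodgeStructureEndAlgCentralizerBlocks
import Literature.AlgebraicGeometry.Motives.HodgeStructureEndActionBlockDimension
import Literature.AlgebraicGeometry.Motives.HodgeStructureCentralizerEquivariantFormsPoints
import HarnessLib

/-!
# Milne 1999 §2, type IV (any `d`) on points: for `ι(F)` CENTRAL in `E_φ` (`F` Milne's CM centre, Rosati `= σ` on `ι(F)`),
# `S(H)(K) ≅ ∏_{s ∈ Φ} Aut_{E_φ ⊗ K}(V_{K,τₛ})` ("`S(A)_{/k^al} = ∏ S_σ`, `S_σ ≈ Aut_{M_d(k^al)}(V₁)`") and, once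
# `E_φ ⊗ K` is split on the block by `ρₛ : M_ι(K) → End_K(V_{K,τₛ})`, `≅ ∏_{s ∈ Φ} GL(e V_{K,τₛ})` ("`≈ GL_{g/df}(k^al)`");
# for `K` algebraically closed and `E_φ` central simple over `ι(F)` the splittings EXIST (Wedderburn), so outright
# `S(H)(K) ≅ ∏_{s ∈ Φ} GL_m(K)`, `m = dim_ℚ V / ([F:ℚ]·d)`, `d²·[F:ℚ] = dim_ℚ E_φ`; and the centralizer ALGEBRA
# `C(H)(K) ≃ₐ[K] ∏ₜ End_K(e V_{K,τₜ}) ≃ₐ[K] ∏ₜ M_m(K)` ("`C(A) ⊗_k k^al = ∏ C_σ`, `C_σ ≈ M_{g/df}(k^al) × M_{g/df}(k^al)`")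

[topic AlgebraicGeometry/Motives]

Layer `Literature/AlgebraicGeometry/Motives`, lane `lit-hodgefound` (Track 2 foundations library; seat `lit-hodgefound-p34`,
generation 22, self-proposed row g22-#3, FILE 2 of 2 — FILE 1 is `Motives/HodgeStructureEndActionCentralBlocks` (the restricted
operators `a_K|V_{K,χ}` and, for `K` algebraically closed, the Wedderburn EXISTENCE of the splittings); free pointer (k) of the
seat sheet: "type IV with `d > 1` on the Hodge-structure side").
Milne computes the Lefschetz group of a simple abelian variety of type IV over `k^al` only: the centre `K` of `E = End⁰(A)` is a
CM field, `E ⊗_ℚ k^al = ∏_{σ : F → k^al} E_σ` along the embeddings of the totally real subfield `F = K^†`, each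
`K_σ = K ⊗_{F,σ} k^al = k^al × k^al` splits `V_σ = V₁ ⊕ V₂`, and `S_σ ≈ Aut_{M_d(k^al)}(V₁) ≈ GL_{g/df}(k^al)` — the form
condition disappears because `e_D` pairs `V₁` with `V₂` (Remark 2.2) and the matrix algebra is removed by Morita theory
(Remarks 2.3–2.4). This file is that argument on the abstract polarized `ℚ`-Hodge structure, on `K`-points, on top of the
seat's g21-#1 (`Deligne1982/InvolutionPairedWeightSpaces`: `formUnitaryGroup`, `formUnitaryGroupEquiv`), its FILE 2
(`Motives/HodgeStructureLefschetzGroupUnitarySplitting`: the perfect pairing of the partner blocks), g22-#2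
(`Motives/HodgeStructureLefschetzGroupQuaternionBlocks`: `Polarization.formUnitaryGroupEquivEigenBlocks`,
`Polarization.lefschetzGroupBaseChange_le_formUnitaryGroup`) and g21-#3 (`LinearAlgebra/Matrix/MatrixAlgebraModuleCorner`:
the corner `eV`, `isometryCentralizerCornerEquiv`, `centralizerCornerAlgEquiv`), FILE 1 (`EndAction.blockOp`,
`EndAction.BlockEnd`, `EndAction.exists_matrixAlgHom_span_blockOp_eq_range`) and g22-#4
(`Motives/HodgeStructureEndAlgCentralizerBlocks`: `EndAction.blockCommutant`, `EndAction.centralizerBaseChangeAlgEquivBlocks :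
C(H)(K) ≃ₐ[K] ∏ₜ C_{τₜ}`): definitions WITH BODIES (`EndAction.blockCentralizer`,
`Polarization.lefschetzGroupBaseChangeEquivBlockCentralizers`, `EndAction.blockCentralizerEquivCorner`,
`Polarization.lefschetzGroupBaseChangeEquivCornerBlocks`, `EndAction.blockCommutantEquivCorner`,
`EndAction.centralizerBaseChangeAlgEquivCornerBlocks`) and theorems; no named fact (net debt `0`).

CARRIER AND HYPOTHESES. `H : HodgeStructure V n`, `Q : Polarization H`, a number field `F` — Milne's CENTRE `K` of `E`, a CM
field — acting by `A : EndAction H F` with `hcent : ι(F) ⊆ Z(E_φ)` (`∀ a ∈ E_φ, a ι(f) = ι(f) a`), an involution `σ` of `F`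
(complex conjugation of the centre, `= †|K`) with the Rosati condition `hros : Q(ι(a)v, w) = Q(v, ι(σa)w)`; a field `K ⊇ ℚ`
(Milne's `k^al`) with an injective family `τ : S → Hom(F, K)` of `card S = [F:ℚ]` embeddings, the index involution `κ`
(`τ (κ s) = τ s ∘ σ`) and a set `Φ ⊆ S` of representatives of its pairs (`hΦ₁`, `hΦ₂`) — for each `σ₀ : F₀ → k^al`
(`F₀ = F^σ`, Milne's `F`) the pair of its extensions, i.e. Milne's "`K_σ = k^al × k^al`, `V_σ = V₁ ⊕ V₂`", `Φ` picking `V₁`.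
§3 adds, for each `s ∈ Φ`, a unital `ρₛ : M_{ιₛ}(K) →ₐ[K] End_K(V_{K,τₛ})` with `hρ : K·(E_φ|V_{K,τₛ}) = ρₛ(M_{ιₛ}(K))` — a
splitting `E_φ ⊗_{F,τₛ} K ≅ M_d(K)` of the simple factor acting on the block (Milne: "there exist compatible isomorphisms
`E_σ → Ē = M_d(k^al) × M_d(k^al)`", one matrix factor per block; `d = card ιₛ`); FILE 1 PRODUCES them for `K` algebraically
closed (`[IsAlgClosed K]`) when `E_φ` is simple (`[IsSimpleRing H.endAlg]`) with centre exactly `ι(F)`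
(`hcen : Z(E_φ) ⊆ ι(F)`) — Milne's "`E` is a division algebra whose centre is a CM-field `K`" — and §4 assembles.

## The source, verbatim

J. S. Milne, *Lefschetz classes on abelian varieties*, Duke Math. J. **96** (1999) 639–675 [Milne1999LefschetzClasses]
(held `paper:doi-10-1215-s0012-7094-99-09620-5`; Duke page = folio + 638), §2 pp. 648, 650–651 (p0010, p0012–p0013):
* (Remark 2.3, p. 648 L8–L22) "Consider the abstract situation: `k` is a field, `E` is a simple `k`-algebra with centre a field
  `K` of finite degree over `k`, and `V` is a left `E`-module. Then the centralizer `C(E)` of `E` in `End_k(V)` is equal to its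
  centralizer in `End_K(V)`, and the canonical homomorphism `E ⊗_K C(E) → End_K(V)` is an isomorphism. […]
  `E ≈ M_r(Δ^opp) ⟹ C(E) ≈ M_t(Δ)`, `t = dim_K(V) / (r[Δ:K])`."
* (Remark 2.4, p. 648 L26–L36) "Let `R` be a `k`-algebra with an involution `†`, and endow `M_m(R)` with the involution
  `(a_{ij}) ↦ (a†_{ji})`. Let `e` be the matrix with `1` in the `(1,1)` position and zeros elsewhere. The map
  `(V, φ) ↦ (eV, φ|eV)` defines an equivalence from the category of pairs `(V, φ)` consisting of a finitely-generated projective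
  `M_m(R)`-module `V` and a (skew) Hermitian form `φ : V × V → M_m(R)`, to the category of pairs `(V, φ)` consisting of a
  finitely-generated projective `R`-module `V` and a (skew) Hermitian form `φ : V × V → R`. […] (Knus 1991, I.9.5)."
* (type IV, p. 650 L63–L66) "In this case `E` is a division algebra whose centre is a CM-field `K`. We shall compute `C(A)` and
  `S(A)` over `k^al` only. Recall that `d = [E:K]^{1/2}` and that `fd | g`. Let `S` be a simple `M_d(k^al)`-module, and let
  `V₁ = S ⊕ ⋯ ⊕ S` (`g/df` copies). Then `V₁` is a `k^al`-vector space of dimension `g/f`. Let `V₂ = V₁^∨`."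
* (p. 651 L24–L47) "Let `D` be an ample divisor on `A`, and let `φ : V(A) × V(A) → K ⊗_ℚ k` be the skew-Hermitian form such
  that `Tr_{K/ℚ} ∘ φ = e_D`. Corresponding to the decomposition `F ⊗_ℚ k^al = ∏_{σ:F→k^al} k_σ`, `k_σ = k^al`, of `F ⊗_ℚ k^al`
  into a product of fields, there are the decompositions `E ⊗_ℚ k^al = ∏_σ E_σ`, `E_σ = E ⊗_{F,σ} k^al`;
  `K ⊗_ℚ k^al = ∏_σ K_σ`, `K_σ = K ⊗_{F,σ} k^al`; `(V(A), φ) ⊗_k F ⊗_ℚ k^al = ⊕_σ (V_σ, φ_σ)`, `(V_σ, φ_σ) = (V(A), φ) ⊗_{F,σ} k^al`."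
* (p. 651 L49–L81) "Using Remarks 2.2, 2.3, and 2.4, we find that, for each `σ`, there exist compatible isomorphisms
  `E_σ → Ē`, `(V_σ, φ_σ) → (V̄, φ̄)`, the first of which carries the Rosati involution on `E_σ` into the involution `†` on `Ē`,
  and therefore maps `K_σ` isomorphically onto `K̄` and `F_σ` isomorphically onto `F̄`. Consequently, `C(A) ⊗_k k^al = ∏ C_σ`,
  where `C_σ ≈ End_Ē(V̄) ≈ M_{g/df}(k^al) × M_{g/df}(k^al)`. Moreover, `S(A)_{/k^al} = ∏ S_σ` where
  `S_σ ≈ Aut_{M_d(k^al)}(V₁) ≈ GL_{g/df}(k^al)`. The representation of `S_σ` on `V_σ` is isomorphic to the direct sum of `d`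
  copies of the standard representation of `GL_{g/df}(k^al)` and `d` copies of its contragredient."

DICTIONARY. `ι(F) ⊗ K` splits `K ⊗ V = ⊕ₜ V_{K,τₜ}` (the tree's `EndAction.eigenspaceBaseChange`); since `ι(F)` is central,
EVERY `a ∈ E_φ` preserves each block (FILE 1, `EndAction.blockOp` = `a_K|V_{K,χ}`), and Milne's `Aut_{M_d(k^al)}(V₁)` — the
automorphisms of `V₁` commuting with `E_σ` — is `EndAction.blockCentralizer` (= `MatrixAlgAction.isometryCentralizer` of the
restricted operators for the ZERO form: no form condition on a single block, exactly as in Remark 2.2). With a splitting `ρₛ`,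
"`≈ GL_{g/df}(k^al)`" is `MatrixAlgAction.isometryCentralizerCornerEquiv` for the zero form: `g ↦ g|eV_{K,τₛ}`,
`e = ρₛ(E_{i₀i₀})`, and `card ι · dim_K eV_{K,τₛ} · [F:ℚ] = dim_ℚ V` is Milne's `d · (g/df) · 2f = 2g`.

## What is PROVED

* §1 DEF **`EndAction.blockCentralizer`** (`Aut_{E_φ ⊗ K}(V_{K,χ})`, on FILE 1's `EndAction.blockOp`), `EndAction.mem_blockCentralizer_iff`.
* §2 `Polarization.formUnitaryGroupEquivEigenBlocks_mem_blockCentralizer` (blocks of `γ ∈ S(H)(K)` commute with `E_φ ⊗ K`),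
  the converse (with `Q_K(a_K x, y) = Q_K(x, (a†)_K y)` = the tree's
  `Motives/HodgeStructureCentralizerEquivariantFormsPoints.Polarization.baseChange_form_baseChange_apply_eq_adjoint`)
  `Polarization.apply_baseChange_eq_of_mem_formUnitaryGroup_of_central` (on the PARTNER block `V_{K,τₛ∘σ}`, by the perfect
  pairing of FILE 2 and `E_φ† = E_φ` — Milne's "`d` copies of its contragredient") and `…_of_central_of_forall` (on
  `K ⊗ V = ⊕ V_{K,τₜ}`); DEF **`Polarization.lefschetzGroupBaseChangeEquivBlockCentralizers :
  S(H)(K) ≃* ∏_{s ∈ Φ} Aut_{E_φ ⊗ K}(V_{K,τₛ})`** (it IS restriction: `coe_…_apply`), and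
  `Polarization.exists_unique_mem_lefschetzGroupBaseChange_restrict_eq_of_central` (every family of `E_φ ⊗ K`-automorphisms of
  the representative blocks is the family of blocks of a unique `γ ∈ S(H)(K)`).
* §3 `EndAction.isometryCentralizer_span_eq` (commuting with operators = with their `K`-span),
  `EndAction.blockCentralizer_eq_isometryCentralizer_range`, `EndAction.isometryCentralizer_empty_cornerForm_zero_eq_top`,
  DEF **`EndAction.blockCentralizerEquivCorner : Aut_{E_φ ⊗ K}(V_{K,τₛ}) ≃* GL(e V_{K,τₛ})`** (`coe_…_apply`: it IS
  restriction to `eV_{K,τₛ}`), DEF **`Polarization.lefschetzGroupBaseChangeEquivCornerBlocks :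
  S(H)(K) ≃* ∏_{s ∈ Φ} GL(e V_{K,τₛ})`** (`coe_…_apply`), and the count `card_mul_finrank_corner` (`card ι · dim eW = dim W`,
  generic), **`EndAction.card_mul_finrank_corner_mul_finrank`** (`card ιₛ · dim_K eV_{K,τₛ} · [F:ℚ] = dim_ℚ V`),
  `EndAction.card_mul_finrank_corner_eq_div`.
* §4 the capstone **`Polarization.exists_lefschetzGroupBaseChange_mulEquiv_pi_generalLinear`** (FILE 1's
  `EndAction.exists_matrixAlgHom_span_blockOp_eq_range` — for `K` algebraically closed and `E_φ` simple with centre exactly the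
  central `ι(F)` every block has a splitting, all of the same size `d` — fed into §3): `∃ d ≥ 1` with `d²·[F:ℚ] = dim_ℚ E_φ`,
  `d ∣ dim_ℚ V/[F:ℚ]` and `S(H)(K) ≃* ∏_{s ∈ Φ} GL_m(K)`, `m = dim_ℚ V/[F:ℚ]/d` ("`S(A)_{/k^al} = ∏_σ S_σ`,
  `S_σ ≈ GL_{g/df}(k^al)`": `2g = dim_ℚ V`, `2f = [F:ℚ]`).
* §5 the centralizer ALGEBRA (Milne's `C(A)`, no polarization, ALL `[F:ℚ]` blocks): `centralizer_coe_span` (generic),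
  `EndAction.blockCommutant_eq_centralizer_range`, DEF **`EndAction.blockCommutantEquivCorner : C_{τₜ} ≃ₐ[K] End_K(e V_{K,τₜ})`**
  (`coe_…_apply`), DEF **`EndAction.centralizerBaseChangeAlgEquivCornerBlocks : C(H)(K) ≃ₐ[K] ∏ₜ End_K(e V_{K,τₜ})`** given
  splittings of all blocks (`coe_…_apply`), and outright over an algebraically closed `K` for `E_φ` simple with centre exactly
  the central `ι(F)`: **`exists_centralizer_baseChange_algEquiv_pi_matrix`** — `∃ d ≥ 1`, `d²·[F:ℚ] = dim_ℚ E_φ`,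
  `d ∣ dim_ℚ V/[F:ℚ]`, `C(H)(K) ≃ₐ[K] ∏ₜ M_m(K)`, `m = dim_ℚ V/[F:ℚ]/d` ("`C(A) ⊗_k k^al = ∏ C_σ`,
  `C_σ ≈ M_{g/df}(k^al) × M_{g/df}(k^al)`" — one factor for each of the `2f` blocks).

NOT here (honest): splittings over a NON-closed `K` (FILE 1 needs `K` algebraically closed; for `K` merely containing the
embeddings one needs `K` to split `E_φ ⊗_{F,τₛ} K` — Brauer group, not in the tree for `E_φ`; §3 takes the `ρₛ` as data);
the compatibility of the splittings with `φ̄` and the involution `†` (not needed for `S`, whose blocks carry no form condition,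
nor for `C(A)` as an ALGEBRA (§5); needed for `(C(A), †)` as an algebra with involution — the involution pairs the factors of
conjugate blocks, not treated); that a type IV `E_φ` IS a central division algebra over a CM
centre acting through `ι` with the Rosati involution inducing complex conjugation on it (Albert's classification — hypotheses
`hcent`, `hcen`, `[IsSimpleRing E_φ]`, `hros` here); the representation-theoretic sentence ("`d` copies of the standard
representation and `d` copies of its contragredient") beyond `MatrixAlgAction.cornerDecomposition : V_{K,τₛ} ≅ (eV)^{ιₛ}` BY
NAME and the contragredient partner blocks of FILE 2; the rational structure over a non-closed `k`. HC is NOT proved; nothing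
here claims a case of the Hodge conjecture.

## References

* [Milne1999LefschetzClasses] J. S. Milne, *Lefschetz classes on abelian varieties*, Duke Math. J. 96 (1999) 639–675 — §1 p. 642
  (Rosati adjunction), §2 Remarks 2.2–2.4 (pp. 647–648), pp. 650–651 (type IV).
* [Deligne1982HodgeCycles] P. Deligne, *Hodge cycles on abelian varieties*, LNM 900 (1982) — §4 (the decomposition
  `H¹_B ⊗ ℂ = ⊕_σ H¹_{B,σ}` along the action of a field).
* [KnusEtAl1998] M.-A. Knus, A. Merkurjev, M. Rost, J.-P. Tignol, *The Book of Involutions*, AMS Colloquium Publications 44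
  (1998), Ch. I §4.A (Morita theory for modules over `M_m(R)`; Milne's "Knus 1991, I.9.5").
-/

noncomputable section

open scoped TensorProduct
open Function Module

namespace Literature.AlgebraicGeometry.Motives

open Literature.LinearAlgebra.Matrix (MatrixAlgAction.isometryCentralizer MatrixAlgAction.mem_isometryCentralizer_iff
  MatrixAlgAction.mem_isometryCentralizer_empty_iff MatrixAlgAction.corner MatrixAlgAction.cornerForm MatrixAlgAction.cornerForm_apply
  MatrixAlgAction.isometryCentralizerCornerEquiv MatrixAlgAction.coe_isometryCentralizerCornerEquiv_apply MatrixAlgAction.cornerDecomposition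
  MatrixAlgAction.centralizerCornerAlgEquiv MatrixAlgAction.centralizerCornerAlgEquiv_apply MatrixAlgAction.coe_cornerRestrict_apply)

/-- **`card ι · dim_L (eW) = dim_L W`** for a unital `M_ι(L)`-module `W` over a field (`W ≅ (eW)^ι`): the count in Milne's
"`C(E) ≈ M_t(Δ)`, `t = dim_K(V)/(r[Δ:K])`" for `Δ = K`. [cite: Milne1999LefschetzClasses, §2 Remark 2.3 (p. 648 L19–L22)]
-- TODO(move): belongs next to `MatrixAlgAction.cornerDecomposition` in `LinearAlgebra/Matrix/MatrixAlgebraModuleCorner`. -/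
theorem card_mul_finrank_corner {L : Type*} [Field L] {W : Type*} [AddCommGroup W] [Module L W] [Module.Finite L W]
    {ι : Type*} [Fintype ι] [DecidableEq ι] (ρ : Matrix ι ι L →ₐ[L] Module.End L W) (i₀ : ι) :
    Fintype.card ι * finrank L (MatrixAlgAction.corner ρ i₀) = finrank L W := by
  rw [(MatrixAlgAction.cornerDecomposition ρ i₀).finrank_eq, Module.finrank_pi_fintype, Finset.sum_const, Finset.card_univ,
    smul_eq_mul]

namespace HodgeStructure

universe u uK

variable {V : Type u} [AddCommGroup V] [Module ℚ V] {n : ℤ} {H : HodgeStructure V n}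
variable {F : Type*} [Field F] [NumberField F]
variable (K : Type uK) [Field K] [Algebra ℚ K] (A : EndAction H F) {S : Type*} (τ : S → (F →ₐ[ℚ] K))
variable (Q : Polarization H) (σ : F ≃ₐ[ℚ] F)

/-! ## §1 `Aut_{E_φ ⊗ K}(V_{K,χ})`: the automorphisms of a block commuting with the restricted operators `a_K|V_{K,χ}` of FILE 1 -/

/-- **`Aut_{E_φ ⊗ K}(V_{K,χ})`**: the automorphisms of the block `V_{K,χ}` commuting with every restricted operator
`a_K|V_{K,χ}`, `a ∈ E_φ` — Milne's `S_σ ≈ Aut_{M_d(k^al)}(V₁)` before any splitting of `E ⊗_{F,σ} k^al` (realised as the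
centralizer-isometry group of `LinearAlgebra/Matrix/MatrixAlgebraModuleCorner` for the ZERO form, i.e. with no form condition).
[cite: Milne1999LefschetzClasses, §2 p. 651 L72–L79 ("S(A)_{/k^al} = ∏ S_σ where S_σ ≈ Aut_{M_d(k^al)}(V₁)")] -/
def EndAction.blockCentralizer (hcent : ∀ a ∈ H.endAlg, ∀ f : F, a * A.ι f = A.ι f * a) (χ : F →ₐ[ℚ] K) :
    Subgroup (A.eigenspaceBaseChange K χ ≃ₗ[K] A.eigenspaceBaseChange K χ) :=
  MatrixAlgAction.isometryCentralizer (L := K) (W := A.eigenspaceBaseChange K χ) (Set.range (A.blockOp K hcent χ)) 0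

/-- Membership in `Aut_{E_φ ⊗ K}(V_{K,χ})`: commute with every `a_K|V_{K,χ}`. [cite: Milne1999LefschetzClasses, §2 p. 651 L72–L79] -/
theorem EndAction.mem_blockCentralizer_iff (hcent : ∀ a ∈ H.endAlg, ∀ f : F, a * A.ι f = A.ι f * a) (χ : F →ₐ[ℚ] K)
    (g : A.eigenspaceBaseChange K χ ≃ₗ[K] A.eigenspaceBaseChange K χ) :
    g ∈ A.blockCentralizer K hcent χ ↔
      ∀ (a : H.endAlg) (x : A.eigenspaceBaseChange K χ),
        ((g (A.blockOp K hcent χ a x) : A.eigenspaceBaseChange K χ) : K ⊗[ℚ] V) =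
          (a : Module.End ℚ V).baseChange K (g x : K ⊗[ℚ] V) := by
  rw [EndAction.blockCentralizer, MatrixAlgAction.mem_isometryCentralizer_iff]
  simp only [Set.forall_mem_range, LinearMap.zero_apply, implies_true, and_true]
  refine forall_congr' fun a => forall_congr' fun x => ?_
  rw [← A.coe_blockOp_apply K hcent χ a (g x)]
  exact ⟨fun h => congr_arg Subtype.val h, fun h => Subtype.ext h⟩


/-! ## §2 `S(H)(K) ≃* ∏_{s ∈ Φ} Aut_{E_φ ⊗ K}(V_{K,τₛ})` by restriction ("`S(A)_{/k^al} = ∏_σ S_σ`, `S_σ ≈ Aut_{M_d(k^al)}(V₁)`") -/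

section Splitting

variable [Fintype S] [Module.Finite ℚ V] (κ : S → S) (Φ : Finset S)
variable (hτ : Injective τ) (hcard : Fintype.card S = finrank ℚ F)
  (hros : ∀ a v w, Q.form (A.ι a v) w = Q.form v (A.ι (σ a) w)) (hσ : ∀ a, σ (σ a) = a)
  (hκ : ∀ s, τ (κ s) = (τ s).comp (σ : F →ₐ[ℚ] F))
  (hΦ₁ : ∀ s, s ∈ Φ ∨ κ s ∈ Φ) (hΦ₂ : ∀ s ∈ Φ, κ s ∉ Φ)
  (hcent : ∀ a ∈ H.endAlg, ∀ f : F, a * A.ι f = A.ι f * a)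

/-- **The blocks of `γ ∈ S(H)(K)` commute with `E_φ ⊗ K`**: `γ|V_{K,τₛ} ∈ Aut_{E_φ ⊗ K}(V_{K,τₛ})`.
[cite: Milne1999LefschetzClasses, §2 p. 651 L64–L79 ("C(A) ⊗_k k^al = ∏ C_σ … S(A)_{/k^al} = ∏ S_σ")] -/
theorem Polarization.formUnitaryGroupEquivEigenBlocks_mem_blockCentralizer (γ : Q.lefschetzGroupBaseChange K) (s : Φ) :
    Q.formUnitaryGroupEquivEigenBlocks K A τ σ κ Φ hτ hcard hros hσ hκ hΦ₁ hΦ₂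
        ⟨γ, Q.lefschetzGroupBaseChange_le_formUnitaryGroup K A γ.2⟩ s ∈ A.blockCentralizer K hcent (τ s) := by
  rw [A.mem_blockCentralizer_iff K hcent]
  intro a x
  rw [Q.coe_formUnitaryGroupEquivEigenBlocks_apply K A τ σ κ Φ hτ hcard hros hσ hκ hΦ₁ hΦ₂, A.coe_blockOp_apply K hcent,
    Q.coe_formUnitaryGroupEquivEigenBlocks_apply K A τ σ κ Φ hτ hcard hros hσ hκ hΦ₁ hΦ₂]
  exact Q.apply_baseChange_of_mem_lefschetzGroupBaseChange K (a : Module.End ℚ V) a.2 γ.2 x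

section Converse

include hτ hcard hros hσ hκ hcent

/-- **The converse on a partner block**: if `u ∈ U(φ₁)(K)` commutes with every `a_K`, `a ∈ E_φ`, on the representative block
`V_{K,τₛ}`, it does so on the partner block `V_{K,τₛ∘σ}` — `u a_K y − a_K u y` is `Q_K`-orthogonal to `u(V_{K,τₛ}) = V_{K,τₛ}`
(move `a` across as `a†`, which lies in `E_φ`), hence `0` by the PERFECT pairing ("the representation of `S_σ` on `V_σ` is …
`d` copies of the standard representation and `d` copies of its contragredient"). [cite: Milne1999LefschetzClasses, §2 p. 651 L79–L81 and Remark 2.2 (p. 647 L48 – p. 648 L7)] -/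
theorem Polarization.apply_baseChange_eq_of_mem_formUnitaryGroup_of_central {u : (K ⊗[ℚ] V) ≃ₗ[K] (K ⊗[ℚ] V)}
    (hu : letI : Module F V := Module.compHom V (A.ι : F →+* Module.End ℚ V)
      haveI : IsScalarTower ℚ F V := A.isScalarTower_compHom
      u ∈ Deligne1982.formUnitaryGroup F K Q.form)
    {s : S} (hcomm : ∀ a ∈ H.endAlg, ∀ x ∈ A.eigenspaceBaseChange K (τ s), u (a.baseChange K x) = a.baseChange K (u x))
    (hsurj : ∀ x ∈ A.eigenspaceBaseChange K (τ s), ∃ x₀ ∈ A.eigenspaceBaseChange K (τ s), u x₀ = x)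
    {a : Module.End ℚ V} (ha : a ∈ H.endAlg) {y : K ⊗[ℚ] V}
    (hy : y ∈ A.eigenspaceBaseChange K ((τ s).comp (σ : F →ₐ[ℚ] F))) :
    u (a.baseChange K y) = a.baseChange K (u y) := by
  letI : Module F V := Module.compHom V (A.ι : F →+* Module.End ℚ V)
  haveI : IsScalarTower ℚ F V := A.isScalarTower_compHom
  have hperf := Q.isPerfPair_baseChange_form_eigenspaceBaseChange K A τ σ κ hτ hcard hros hσ hκ s
  have hay : a.baseChange K y ∈ A.eigenspaceBaseChange K ((τ s).comp (σ : F →ₐ[ℚ] F)) :=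
    A.baseChange_apply_mem_eigenspaceBaseChange_of_central K hcent ha hy
  have h1 : u (a.baseChange K y) ∈ A.eigenspaceBaseChange K ((τ s).comp (σ : F →ₐ[ℚ] F)) :=
    Q.apply_mem_eigenspaceBaseChange_of_mem_formUnitaryGroup K A hu _ hay
  have h2 : a.baseChange K (u y) ∈ A.eigenspaceBaseChange K ((τ s).comp (σ : F →ₐ[ℚ] F)) :=
    A.baseChange_apply_mem_eigenspaceBaseChange_of_central K hcent ha
      (Q.apply_mem_eigenspaceBaseChange_of_mem_formUnitaryGroup K A hu _ hy)
  have ha' : Q.adjoint a ∈ H.endAlg := Q.adjoint_mem_endAlg ha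
  -- `Q_K(x, u a y − a u y) = 0` for every `x ∈ V_{K,τₛ}`
  have hzero : ∀ x ∈ A.eigenspaceBaseChange K (τ s),
      Q.form.baseChange K x (u (a.baseChange K y) - a.baseChange K (u y)) = 0 := by
    intro x hx
    obtain ⟨x₀, hx₀, rfl⟩ := hsurj x hx
    have hiso := ((Deligne1982.mem_formUnitaryGroup_iff Q.form u).1 hu).2
    have hadj : ∀ v w : K ⊗[ℚ] V, Q.form.baseChange K v (a.baseChange K w) =
        Q.form.baseChange K ((Q.adjoint a).baseChange K v) w := fun v w => by
      rw [Q.baseChange_form_baseChange_apply_eq_adjoint K (Q.adjoint a), Q.adjoint_adjoint]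
    have e1 : Q.form.baseChange K (u x₀) (u (a.baseChange K y)) = Q.form.baseChange K ((Q.adjoint a).baseChange K x₀) y := by
      rw [hiso, hadj]
    have e2 : Q.form.baseChange K (u x₀) (a.baseChange K (u y)) = Q.form.baseChange K ((Q.adjoint a).baseChange K x₀) y := by
      rw [hadj, ← hcomm _ ha' x₀ hx₀, hiso]
    rw [map_sub, e1, e2, sub_self]
  set d : A.eigenspaceBaseChange K ((τ s).comp (σ : F →ₐ[ℚ] F)) :=
    ⟨u (a.baseChange K y) - a.baseChange K (u y), Submodule.sub_mem _ h1 h2⟩ with hd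
  have hflip : ((Q.form.baseChange K).compl₁₂ (A.eigenspaceBaseChange K (τ s)).subtype
      (A.eigenspaceBaseChange K ((τ s).comp (σ : F →ₐ[ℚ] F))).subtype).flip d = 0 := by
    refine LinearMap.ext fun x => ?_
    rw [LinearMap.flip_apply, LinearMap.compl₁₂_apply, Submodule.subtype_apply, Submodule.subtype_apply, hd,
      LinearMap.zero_apply]
    exact hzero x x.2
  have hd0 : d = 0 := hperf.bijective_right.injective (hflip.trans (map_zero _).symm)
  exact sub_eq_zero.1 (congr_arg Subtype.val hd0)

include hΦ₁

/-- **`u ∈ U(φ₁)(K)` commuting with `E_φ ⊗ K` on the representative blocks commutes with `E_φ ⊗ K`** (representative blocks by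
hypothesis, partner blocks by the previous lemma, then `K ⊗ V = ⊕ₜ V_{K,τₜ}`). [cite: Milne1999LefschetzClasses, §2 p. 651 L64–L81] -/
theorem Polarization.apply_baseChange_eq_of_mem_formUnitaryGroup_of_central_of_forall {u : (K ⊗[ℚ] V) ≃ₗ[K] (K ⊗[ℚ] V)}
    (hu : letI : Module F V := Module.compHom V (A.ι : F →+* Module.End ℚ V)
      haveI : IsScalarTower ℚ F V := A.isScalarTower_compHom
      u ∈ Deligne1982.formUnitaryGroup F K Q.form)
    (hcomm : ∀ s ∈ Φ, ∀ a ∈ H.endAlg, ∀ x ∈ A.eigenspaceBaseChange K (τ s), u (a.baseChange K x) = a.baseChange K (u x))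
    (hsurj : ∀ s ∈ Φ, ∀ x ∈ A.eigenspaceBaseChange K (τ s), ∃ x₀ ∈ A.eigenspaceBaseChange K (τ s), u x₀ = x)
    {a : Module.End ℚ V} (ha : a ∈ H.endAlg) (x : K ⊗[ℚ] V) : u (a.baseChange K x) = a.baseChange K (u x) := by
  have hblock : ∀ t, ∀ y ∈ A.eigenspaceBaseChange K (τ t), u (a.baseChange K y) = a.baseChange K (u y) := by
    intro t
    rcases hΦ₁ t with ht | ht
    · exact fun y hy => hcomm t ht a ha y hy
    · intro y hy
      have hts : (τ (κ t)).comp (σ : F →ₐ[ℚ] F) = τ t := by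
        rw [hκ]; exact AlgHom.ext fun c => by simp [hσ c]
      rw [← hts] at hy
      exact Q.apply_baseChange_eq_of_mem_formUnitaryGroup_of_central K A τ σ κ hτ hcard hros hσ hκ hcent hu
        (hcomm _ ht) (hsurj _ ht) ha hy
  have h := A.linearMap_eq_of_forall_apply_mem_eq K τ hτ hcard
    (f := (u : Module.End K (K ⊗[ℚ] V)) ∘ₗ a.baseChange K) (g := a.baseChange K ∘ₗ (u : Module.End K (K ⊗[ℚ] V)))
    fun t y hy => by simpa using hblock t y hy
  exact LinearMap.congr_fun h x

end Converse

section Main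

include hcent

/-- **Milne's type IV (any `d`) on `K`-points, first step: `S(H)(K) ≃* ∏_{s ∈ Φ} Aut_{E_φ ⊗ K}(V_{K,τₛ})`,
`γ ↦ (γ|V_{K,τₛ})_{s ∈ Φ}`** — for `ι(F)` central in `E_φ`, the Rosati condition `Q(ι(a)v, w) = Q(v, ι(σa)w)` for an
involution `σ` of `F`, a field `K` admitting all `[F:ℚ]` embeddings `τₛ`, the index involution `κ` and a set `Φ` of
representatives of its pairs: "`S(A)_{/k^al} = ∏ S_σ` where `S_σ ≈ Aut_{M_d(k^al)}(V₁)`" (the inverse extends a family of blocks by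
their contragredients, which commute with `E_φ ⊗ K` because `E_φ† = E_φ`). [cite: Milne1999LefschetzClasses, §2 p. 651 L64–L81] -/
def Polarization.lefschetzGroupBaseChangeEquivBlockCentralizers :
    Q.lefschetzGroupBaseChange K ≃* ∀ s : Φ, A.blockCentralizer K hcent (τ s) :=
  letI : Module F V := Module.compHom V (A.ι : F →+* Module.End ℚ V)
  haveI : IsScalarTower ℚ F V := A.isScalarTower_compHom
  let E := Q.formUnitaryGroupEquivEigenBlocks K A τ σ κ Φ hτ hcard hros hσ hκ hΦ₁ hΦ₂
  { toFun := fun γ s => ⟨E ⟨γ, Q.lefschetzGroupBaseChange_le_formUnitaryGroup K A γ.2⟩ s,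
      Q.formUnitaryGroupEquivEigenBlocks_mem_blockCentralizer K A τ σ κ Φ hτ hcard hros hσ hκ hΦ₁ hΦ₂ hcent γ s⟩
    invFun := fun g => ⟨(E.symm fun s => (g s : A.eigenspaceBaseChange K (τ s) ≃ₗ[K] A.eigenspaceBaseChange K (τ s))).1, by
      set u := E.symm fun s => (g s : A.eigenspaceBaseChange K (τ s) ≃ₗ[K] A.eigenspaceBaseChange K (τ s)) with hu
      have hEu : ∀ s : Φ, E u s = (g s : _ ≃ₗ[K] _) := fun s => congr_fun (E.apply_symm_apply _) s
      have huU := (Deligne1982.mem_formUnitaryGroup_iff Q.form (u : (K ⊗[ℚ] V) ≃ₗ[K] (K ⊗[ℚ] V))).1 u.2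
      rw [Q.mem_lefschetzGroupBaseChange_iff]
      refine ⟨fun a x => ?_, huU.2⟩
      refine (Q.apply_baseChange_eq_of_mem_formUnitaryGroup_of_central_of_forall K A τ σ κ Φ hτ hcard hros hσ hκ hΦ₁ hcent
        u.2 (fun s hs b hb x hx => ?_) (fun s hs x hx => ?_) a.2 x).symm
      · -- on the representative block, `u` IS the block `g s`, which commutes with `b_K|V_{K,τ s}`
        have hg := (A.mem_blockCentralizer_iff K hcent (τ s) _).1 (g ⟨s, hs⟩).2 ⟨b, hb⟩ ⟨x, hx⟩
        rw [← hEu ⟨s, hs⟩, Q.coe_formUnitaryGroupEquivEigenBlocks_apply K A τ σ κ Φ hτ hcard hros hσ hκ hΦ₁ hΦ₂,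
          A.coe_blockOp_apply K hcent, Q.coe_formUnitaryGroupEquivEigenBlocks_apply K A τ σ κ Φ hτ hcard hros hσ hκ hΦ₁ hΦ₂] at hg
        exact hg
      · refine ⟨((E u ⟨s, hs⟩).symm ⟨x, hx⟩ : A.eigenspaceBaseChange K (τ s)), Submodule.coe_mem _, ?_⟩
        rw [← Q.coe_formUnitaryGroupEquivEigenBlocks_apply K A τ σ κ Φ hτ hcard hros hσ hκ hΦ₁ hΦ₂ u ⟨s, hs⟩,
          LinearEquiv.apply_symm_apply]⟩
    left_inv := fun γ => Subtype.ext (by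
      have h := congr_arg Subtype.val (E.symm_apply_apply ⟨γ, Q.lefschetzGroupBaseChange_le_formUnitaryGroup K A γ.2⟩)
      exact h)
    right_inv := fun g => funext fun s => Subtype.ext (congr_fun (E.apply_symm_apply _) s)
    map_mul' := fun γ δ => funext fun s => Subtype.ext (by
      have h := congr_fun (map_mul E ⟨γ, Q.lefschetzGroupBaseChange_le_formUnitaryGroup K A γ.2⟩
        ⟨δ, Q.lefschetzGroupBaseChange_le_formUnitaryGroup K A δ.2⟩) s
      rw [Pi.mul_apply] at h
      exact h) }

/-- The isomorphism IS restriction. [cite: Milne1999LefschetzClasses, §2 p. 651 L72–L79] -/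
theorem Polarization.coe_lefschetzGroupBaseChangeEquivBlockCentralizers_apply (γ : Q.lefschetzGroupBaseChange K) (s : Φ)
    (x : A.eigenspaceBaseChange K (τ s)) :
    ((((Q.lefschetzGroupBaseChangeEquivBlockCentralizers K A τ σ κ Φ hτ hcard hros hσ hκ hΦ₁ hΦ₂ hcent γ s :
        A.blockCentralizer K hcent (τ s)) : A.eigenspaceBaseChange K (τ s) ≃ₗ[K] A.eigenspaceBaseChange K (τ s)) x :
        A.eigenspaceBaseChange K (τ s)) : K ⊗[ℚ] V) = (γ : (K ⊗[ℚ] V) ≃ₗ[K] (K ⊗[ℚ] V)) x :=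
  Q.coe_formUnitaryGroupEquivEigenBlocks_apply K A τ σ κ Φ hτ hcard hros hσ hκ hΦ₁ hΦ₂ _ s x

include hτ hcard hros hσ hκ hΦ₁ hΦ₂ in
/-- **Surjectivity, unbundled**: every family of `E_φ ⊗ K`-automorphisms of the representative blocks is the family of
blocks of a unique `γ ∈ S(H)(K)`. [cite: Milne1999LefschetzClasses, §2 p. 651 L72–L81] -/
theorem Polarization.exists_unique_mem_lefschetzGroupBaseChange_restrict_eq_of_central
    (g : ∀ s : Φ, A.eigenspaceBaseChange K (τ s) ≃ₗ[K] A.eigenspaceBaseChange K (τ s))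
    (hg : ∀ s : Φ, g s ∈ A.blockCentralizer K hcent (τ s)) :
    ∃! γ : Q.lefschetzGroupBaseChange K,
      ∀ (s : Φ) (x : A.eigenspaceBaseChange K (τ s)), (γ : (K ⊗[ℚ] V) ≃ₗ[K] (K ⊗[ℚ] V)) x = g s x := by
  set E := Q.lefschetzGroupBaseChangeEquivBlockCentralizers K A τ σ κ Φ hτ hcard hros hσ hκ hΦ₁ hΦ₂ hcent
  refine ⟨E.symm fun s => ⟨g s, hg s⟩, fun s x => ?_, fun γ hγ => ?_⟩
  · have h := congr_fun (E.apply_symm_apply fun s => ⟨g s, hg s⟩) s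
    rw [← Q.coe_lefschetzGroupBaseChangeEquivBlockCentralizers_apply K A τ σ κ Φ hτ hcard hros hσ hκ hΦ₁ hΦ₂ hcent _ s x, h]
  · rw [MulEquiv.eq_symm_apply]
    funext s
    refine Subtype.ext (LinearEquiv.ext fun x => Subtype.ext ?_)
    rw [Q.coe_lefschetzGroupBaseChangeEquivBlockCentralizers_apply K A τ σ κ Φ hτ hcard hros hσ hκ hΦ₁ hΦ₂ hcent]
    exact hγ s x

end Main

/-! ## §3 Splitting `E_φ ⊗_{F,τₛ} K ≅ M_ι(K)` on the block: `Aut_{E_φ ⊗ K}(V_{K,τₛ}) ≃* GL(e V_{K,τₛ})` (Remarks 2.3–2.4), hence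
`S(H)(K) ≃* ∏_{s ∈ Φ} GL(e V_{K,τₛ})` — "`S_σ ≈ Aut_{M_d(k^al)}(V₁) ≈ GL_{g/df}(k^al)`" -/

section Morita

omit [Fintype S] [Module.Finite ℚ V] in
/-- Commuting with a set of operators on a block is commuting with its `K`-span. [cite: Milne1999LefschetzClasses, §2 Remark 2.3 ("the centralizer C(E) of E")] -/
theorem EndAction.isometryCentralizer_span_eq (χ : F →ₐ[ℚ] K) (T : Set (Module.End K (A.eigenspaceBaseChange K χ)))
    (ψ : LinearMap.BilinForm K (A.eigenspaceBaseChange K χ)) :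
    MatrixAlgAction.isometryCentralizer (L := K) (W := A.eigenspaceBaseChange K χ)
        (Submodule.span K T : Set (Module.End K (A.eigenspaceBaseChange K χ))) ψ =
      MatrixAlgAction.isometryCentralizer (L := K) (W := A.eigenspaceBaseChange K χ) T ψ := by
  ext γ
  rw [MatrixAlgAction.mem_isometryCentralizer_iff, MatrixAlgAction.mem_isometryCentralizer_iff]
  refine and_congr_left fun _ => ⟨fun h t ht => h t (Submodule.subset_span ht), fun h t ht => ?_⟩
  induction ht using Submodule.span_induction with
  | mem t ht => exact h t ht
  | zero => intro v; simp
  | add a b _ _ ha hb => intro v; rw [LinearMap.add_apply, LinearMap.add_apply, map_add, ha, hb]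
  | smul c a _ ha => intro v; rw [LinearMap.smul_apply, LinearMap.smul_apply, map_smul, ha]


variable {ι : Φ → Type*} [∀ s, Fintype (ι s)] [∀ s, DecidableEq (ι s)] (i₀ : ∀ s, ι s)
  (ρ : ∀ s : Φ, Matrix (ι s) (ι s) K →ₐ[K] A.BlockEnd K (τ s))
  (hρ : ∀ s : Φ, Submodule.span K (Set.range (A.blockOp K hcent (τ s))) = LinearMap.range (ρ s).toLinearMap)

omit [Fintype S] [Module.Finite ℚ V] in
include hρ in
/-- **With a splitting `ρₛ : M_ι(K) → End_K(V_{K,τₛ})` of `E_φ ⊗ K` on the block (`K`-span of the restricted operators = `ρₛ(M_ι(K))`):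
`Aut_{E_φ ⊗ K}(V_{K,τₛ})` is the centralizer-isometry group of `ρₛ(M_ι(K))` for the zero form.** [cite: Milne1999LefschetzClasses, §2 p. 651 L64–L70 ("E_σ → Ē … C_σ ≈ End_Ē(V̄)") and Remark 2.3] -/
theorem EndAction.blockCentralizer_eq_isometryCentralizer_range (s : Φ) :
    A.blockCentralizer K hcent (τ s) =
      MatrixAlgAction.isometryCentralizer (L := K) (W := A.eigenspaceBaseChange K (τ s)) (Set.range (ρ s)) 0 := by
  rw [EndAction.blockCentralizer, ← A.isometryCentralizer_span_eq K (τ s) (Set.range (A.blockOp K hcent (τ s))), hρ s,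
    LinearMap.coe_range]
  rfl

omit [Fintype S] [Module.Finite ℚ V] in
/-- The corner form of the zero form is zero, so its isometry group is everything (plumbing for the `GL(eV)` step).
[cite: Milne1999LefschetzClasses, §2 Remark 2.4] -/
theorem EndAction.isometryCentralizer_empty_cornerForm_zero_eq_top (s : Φ) :
    MatrixAlgAction.isometryCentralizer
        (∅ : Set (Module.End K (MatrixAlgAction.corner (ρ s) (i₀ s))))
        (MatrixAlgAction.cornerForm (ρ s) (i₀ s) 0) = ⊤ := by
  ext γ
  rw [MatrixAlgAction.mem_isometryCentralizer_empty_iff]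
  simp [MatrixAlgAction.cornerForm_apply]

omit [Fintype S] [Module.Finite ℚ V] in
/-- **`Aut_{E_φ ⊗ K}(V_{K,τₛ}) ≃* GL(e V_{K,τₛ})`, `g ↦ g|eV_{K,τₛ}`** (`e = ρₛ(E_{i₀i₀})`): Milne's "`S_σ ≈ Aut_{M_d(k^al)}(V₁) ≈ GL_{g/df}(k^al)`",
the second `≈`, by Remarks 2.3–2.4 (`LinearAlgebra/Matrix/MatrixAlgebraModuleCorner.isometryCentralizerCornerEquiv` for the zero form).
[cite: Milne1999LefschetzClasses, §2 p. 651 L79 ("S_σ ≈ Aut_{M_d(k^al)}(V₁) ≈ GL_{g/df}(k^al)") and Remarks 2.3–2.4] -/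
def EndAction.blockCentralizerEquivCorner (s : Φ) :
    A.blockCentralizer K hcent (τ s) ≃* (MatrixAlgAction.corner (ρ s) (i₀ s) ≃ₗ[K] MatrixAlgAction.corner (ρ s) (i₀ s)) :=
  (MulEquiv.subgroupCongr (A.blockCentralizer_eq_isometryCentralizer_range K τ Φ hcent ρ hρ s)).trans
    ((MatrixAlgAction.isometryCentralizerCornerEquiv (ρ s) (i₀ s) 0 fun _ _ _ => rfl).trans
      ((MulEquiv.subgroupCongr (A.isometryCentralizer_empty_cornerForm_zero_eq_top K τ Φ i₀ ρ s)).trans Subgroup.topEquiv))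

omit [Fintype S] [Module.Finite ℚ V] in
/-- The corner isomorphism IS restriction to `eV_{K,τₛ}`. [cite: Milne1999LefschetzClasses, §2 Remark 2.4 ("(V, φ) ↦ (eV, φ|eV)")] -/
theorem EndAction.coe_blockCentralizerEquivCorner_apply (s : Φ) (g : A.blockCentralizer K hcent (τ s))
    (x : MatrixAlgAction.corner (ρ s) (i₀ s)) :
    ((A.blockCentralizerEquivCorner K τ Φ hcent i₀ ρ hρ s g x : MatrixAlgAction.corner (ρ s) (i₀ s)) : A.eigenspaceBaseChange K (τ s)) =
      (g : A.eigenspaceBaseChange K (τ s) ≃ₗ[K] A.eigenspaceBaseChange K (τ s)) x :=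
  MatrixAlgAction.coe_isometryCentralizerCornerEquiv_apply (ρ := ρ s) (i₀ s) 0 (fun _ _ _ => rfl) _ x


include hτ hcard in
/-- **`card ι · dim_K (eV_{K,τₛ}) · [F:ℚ] = dim_ℚ V`** — Milne's `d · (g/df) · 2f = 2g` ("`V₁ = S ⊕ ⋯ ⊕ S` (`g/df` copies) … is a
`k^al`-vector space of dimension `g/f`"). [cite: Milne1999LefschetzClasses, §2 p. 650 L64–L66 and Remark 2.3] -/
theorem EndAction.card_mul_finrank_corner_mul_finrank (s : Φ) :
    Fintype.card (ι s) * finrank K (MatrixAlgAction.corner (ρ s) (i₀ s)) * finrank ℚ F = finrank ℚ V :=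
  (congr_arg (· * finrank ℚ F) (card_mul_finrank_corner (ρ s) (i₀ s))).trans
    (A.finrank_eigenspaceBaseChange_mul_finrank K τ hτ hcard s)

include hτ hcard in
/-- `card ι · dim_K (eV_{K,τₛ}) = dim_ℚ V / [F:ℚ]` (`= dim_K V_{K,τₛ}`). [cite: Milne1999LefschetzClasses, §2 p. 650 L64–L66 and Prop. 2.1] -/
theorem EndAction.card_mul_finrank_corner_eq_div (s : Φ) :
    Fintype.card (ι s) * finrank K (MatrixAlgAction.corner (ρ s) (i₀ s)) = finrank ℚ V / finrank ℚ F :=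
  (card_mul_finrank_corner (ρ s) (i₀ s)).trans (A.finrank_eigenspaceBaseChange_eq_div K τ hτ hcard s)

/-- **Milne's type IV on `K`-points, fully split: `S(H)(K) ≃* ∏_{s ∈ Φ} GL(e V_{K,τₛ})`**, `γ ↦ (γ|eV_{K,τₛ})_{s ∈ Φ}` — for `ι(F)`
central in `E_φ`, the Rosati condition, all `[F:ℚ]` embeddings in `K`, representatives `Φ` of the pairs, and for each `s ∈ Φ`
a splitting `ρₛ : M_ι(K) → End_K(V_{K,τₛ})` of `E_φ ⊗ K` on the block: "`S(A)_{/k^al} = ∏ S_σ` where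
`S_σ ≈ Aut_{M_d(k^al)}(V₁) ≈ GL_{g/df}(k^al)`". [cite: Milne1999LefschetzClasses, §2 p. 651 L64–L81] -/
def Polarization.lefschetzGroupBaseChangeEquivCornerBlocks :
    Q.lefschetzGroupBaseChange K ≃* ∀ s : Φ, (MatrixAlgAction.corner (ρ s) (i₀ s) ≃ₗ[K] MatrixAlgAction.corner (ρ s) (i₀ s)) :=
  (Q.lefschetzGroupBaseChangeEquivBlockCentralizers K A τ σ κ Φ hτ hcard hros hσ hκ hΦ₁ hΦ₂ hcent).trans
    (MulEquiv.piCongrRight fun s => A.blockCentralizerEquivCorner K τ Φ hcent i₀ ρ hρ s)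

/-- The fully split isomorphism IS restriction: `(((equiv γ) s) x : K ⊗ V) = γ x` for `x ∈ eV_{K,τₛ}`.
[cite: Milne1999LefschetzClasses, §2 p. 651 L79 and Remark 2.4] -/
theorem Polarization.coe_lefschetzGroupBaseChangeEquivCornerBlocks_apply (γ : Q.lefschetzGroupBaseChange K) (s : Φ)
    (x : MatrixAlgAction.corner (ρ s) (i₀ s)) :
    (((Q.lefschetzGroupBaseChangeEquivCornerBlocks K A τ σ κ Φ hτ hcard hros hσ hκ hΦ₁ hΦ₂ hcent i₀ ρ hρ γ s x :
        MatrixAlgAction.corner (ρ s) (i₀ s)) : A.eigenspaceBaseChange K (τ s)) : K ⊗[ℚ] V) =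
      (γ : (K ⊗[ℚ] V) ≃ₗ[K] (K ⊗[ℚ] V)) x := by
  rw [Polarization.lefschetzGroupBaseChangeEquivCornerBlocks, MulEquiv.trans_apply, MulEquiv.piCongrRight_apply,
    A.coe_blockCentralizerEquivCorner_apply K τ Φ hcent i₀ ρ hρ,
    Q.coe_lefschetzGroupBaseChangeEquivBlockCentralizers_apply K A τ σ κ Φ hτ hcard hros hσ hκ hΦ₁ hΦ₂ hcent]

end Morita

/-! ## §4 Over an algebraically closed `K` the splittings exist (FILE 1, Wedderburn), hence for `E_φ` central simple over `ι(F)`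
`S(H)(K) ≃* ∏_{s ∈ Φ} GL_{g/df}(K)` outright -/

section Existence

include hτ hcard hros hσ hκ hΦ₁ hΦ₂ hcent in
/-- **Milne's type IV over an algebraically closed field, outright: `S(H)(K) ≅ ∏_{s ∈ Φ} GL_m(K)`, `m = dim_ℚ V / ([F:ℚ] · d)`,
`d² · [F:ℚ] = dim_ℚ E_φ`** — for `E_φ` simple with centre exactly the central `ι(F)`, the Rosati condition
`Q(ι(a)v, w) = Q(v, ι(σa)w)`, `K` algebraically closed with all `[F:ℚ]` embeddings `τ`, representatives `Φ` of the pairs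
`{τₛ, τₛ ∘ σ}`: "`S(A)_{/k^al} = ∏_σ S_σ` where `S_σ ≈ Aut_{M_d(k^al)}(V₁) ≈ GL_{g/df}(k^al)`" (`2g = dim_ℚ V`, `2f = [F:ℚ]` for
Milne's CM centre `K = F` of degree `2f`; §3 with the splittings of FILE 1's `exists_matrixAlgHom_span_blockOp_eq_range` and a basis of
each corner `eV_{K,τₛ}`, of dimension `g/(df)` by `card_mul_finrank_corner_eq_div`).
[cite: Milne1999LefschetzClasses, §2 p. 651 L72–L81 ("S(A)_{/k^al} = ∏ S_σ where S_σ ≈ Aut_{M_d(k^al)}(V₁) ≈ GL_{g/df}(k^al)")] -/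
theorem Polarization.exists_lefschetzGroupBaseChange_mulEquiv_pi_generalLinear [IsAlgClosed K] [IsSimpleRing H.endAlg]
    (hcen : ∀ z ∈ H.endAlg, (∀ a ∈ H.endAlg, a * z = z * a) → z ∈ Set.range A.ι) :
    ∃ d : ℕ, NeZero d ∧ d ^ 2 * finrank ℚ F = finrank ℚ H.endAlg ∧ d ∣ finrank ℚ V / finrank ℚ F ∧
      Nonempty (Q.lefschetzGroupBaseChange K ≃* ∀ _s : Φ,
        (Fin (finrank ℚ V / finrank ℚ F / d) → K) ≃ₗ[K] (Fin (finrank ℚ V / finrank ℚ F / d) → K)) := by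
  classical
  -- a representative block exists: `card S = [F:ℚ] > 0`
  obtain ⟨s₀⟩ : Nonempty S := Fintype.card_pos_iff.1 (hcard ▸ Module.finrank_pos)
  obtain ⟨t, ht⟩ : ∃ t, t ∈ Φ := (hΦ₁ s₀).elim (fun h => ⟨s₀, h⟩) fun h => ⟨κ s₀, h⟩
  -- splittings of all representative blocks (§4), all of the same size `d`
  choose dρ hdρ hdimρ ρ hρ using fun s : Φ => A.exists_matrixAlgHom_span_blockOp_eq_range K hcent hcen (τ s)
  have hdeq : ∀ s, dρ s = dρ ⟨t, ht⟩ := fun s =>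
    Nat.pow_left_injective two_ne_zero (Nat.eq_of_mul_eq_mul_right Module.finrank_pos ((hdimρ s).trans (hdimρ _).symm))
  -- the count `d · dim eV_{K,τₛ} = dim_ℚ V / [F:ℚ]`
  have hcnt : ∀ s : Φ,
      dρ s * finrank K (MatrixAlgAction.corner (ρ s) (0 : Fin (dρ s))) = finrank ℚ V / finrank ℚ F := fun s => by
    have h := A.card_mul_finrank_corner_eq_div K τ Φ hτ hcard (fun s => (0 : Fin (dρ s))) ρ s
    rwa [Fintype.card_fin] at h
  refine ⟨dρ ⟨t, ht⟩, hdρ _, hdimρ _, Dvd.intro _ (hcnt ⟨t, ht⟩), ⟨?_⟩⟩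
  refine (Q.lefschetzGroupBaseChangeEquivCornerBlocks K A τ σ κ Φ hτ hcard hros hσ hκ hΦ₁ hΦ₂ hcent
    (fun s => (0 : Fin (dρ s))) ρ hρ).trans (MulEquiv.piCongrRight fun s => glConjMulEquiv (LinearEquiv.ofFinrankEq _ _ ?_))
  rw [Module.finrank_fin_fun]
  refine (Nat.div_eq_of_eq_mul_left (Nat.pos_of_ne_zero (hdρ ⟨t, ht⟩).out) ?_).symm
  calc finrank ℚ V / finrank ℚ F = dρ s * finrank K (MatrixAlgAction.corner (ρ s) (0 : Fin (dρ s))) := (hcnt s).symm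
    _ = finrank K (MatrixAlgAction.corner (ρ s) (0 : Fin (dρ s))) * dρ s := mul_comm _ _
    _ = finrank K (MatrixAlgAction.corner (ρ s) (0 : Fin (dρ s))) * dρ ⟨t, ht⟩ :=
        congrArg (finrank K (MatrixAlgAction.corner (ρ s) (0 : Fin (dρ s))) * ·) (hdeq s)

end Existence

/-! ## §5 The centralizer ALGEBRA with splittings of all blocks: `C_{τₜ} ≃ₐ[K] End_K(e V_{K,τₜ})`, hence
`C(H)(K) ≃ₐ[K] ∏ₜ End_K(e V_{K,τₜ})` ("`C(A) ⊗_k k^al = ∏ C_σ`, `C_σ ≈ End_Ē(V̄) ≈ M_{g/df}(k^al) × M_{g/df}(k^al)`") -/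

section Centralizer

omit [Algebra ℚ K] in
/-- Commuting with a set of elements of a `K`-algebra is commuting with its `K`-span. [cite: Milne1999LefschetzClasses, §2 Remark 2.3 ("the centralizer C(E) of E")]
-- TODO(move): generic; the tree's `Milne1999/LefschetzCentraliser.centralizerAlgebra_eq_centralizer_span` is the same argument on `H¹(A, ℂ)`. -/
theorem centralizer_coe_span {B : Type*} [Ring B] [Algebra K B] (T : Set B) :
    Subalgebra.centralizer K (Submodule.span K T : Set B) = Subalgebra.centralizer K T := by
  refine le_antisymm (Subalgebra.centralizer_le K _ _ Submodule.subset_span) fun c hc => ?_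
  rw [Subalgebra.mem_centralizer_iff] at hc ⊢
  intro g hg
  induction hg using Submodule.span_induction with
  | mem x hx => exact hc x hx
  | zero => rw [zero_mul, mul_zero]
  | add x y _ _ hx hy => rw [add_mul, mul_add, hx, hy]
  | smul a x _ hx => rw [smul_mul_assoc, mul_smul_comm, hx]

variable {ι' : S → Type*} [∀ t, Fintype (ι' t)] [∀ t, DecidableEq (ι' t)] (j₀ : ∀ t, ι' t)
  (ρ' : ∀ t : S, Matrix (ι' t) (ι' t) K →ₐ[K] A.BlockEnd K (τ t))
  (hρ' : ∀ t : S, Submodule.span K (Set.range (A.blockOp K hcent (τ t))) = LinearMap.range (ρ' t).toLinearMap)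

omit [Fintype S] [Module.Finite ℚ V] in
include hρ' in
/-- With a splitting `ρₜ` of `E_φ ⊗ K` on the block, **`C_{τₜ}` is the commutant of `ρₜ(M_{ιₜ}(K))`**.
[cite: Milne1999LefschetzClasses, §2 p. 651 L49–L70 ("E_σ → Ē … C_σ ≈ End_Ē(V̄)") and Remark 2.3] -/
theorem EndAction.blockCommutant_eq_centralizer_range (t : S) :
    A.blockCommutant K hcent (τ t) = Subalgebra.centralizer K (Set.range (ρ' t)) := by
  rw [EndAction.blockCommutant, ← centralizer_coe_span K (Set.range (A.blockOp K hcent (τ t))), hρ' t, LinearMap.coe_range,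
    ← centralizer_coe_span K (Set.range (ρ' t))]
  congr 1
  exact congrArg SetLike.coe (Submodule.span_eq (LinearMap.range (ρ' t).toLinearMap)).symm

omit [Fintype S] [Module.Finite ℚ V] in
/-- **`C_{τₜ} ≃ₐ[K] End_K(e V_{K,τₜ})`, `c ↦ c|eV_{K,τₜ}`** (`e = ρₜ(E_{j₀j₀})`): Milne's "`C_σ ≈ End_Ē(V̄) ≈ M_{g/df}(k^al) × ⋯`",
one factor per block, by Remark 2.3 (`LinearAlgebra/Matrix/MatrixAlgebraModuleCorner.centralizerCornerAlgEquiv`).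
[cite: Milne1999LefschetzClasses, §2 p. 651 L64–L70 and Remark 2.3 ("E ≈ M_r(Δ^opp) ⟹ C(E) ≈ M_t(Δ)")] -/
def EndAction.blockCommutantEquivCorner (t : S) :
    A.blockCommutant K hcent (τ t) ≃ₐ[K] Module.End K (MatrixAlgAction.corner (ρ' t) (j₀ t)) :=
  (Subalgebra.equivOfEq _ _ (A.blockCommutant_eq_centralizer_range K τ hcent ρ' hρ' t)).trans
    (MatrixAlgAction.centralizerCornerAlgEquiv (ρ' t) (j₀ t))

omit [Fintype S] [Module.Finite ℚ V] in
/-- The corner isomorphism IS restriction: `((equiv c) x : V_{K,τₜ}) = c x`. [cite: Milne1999LefschetzClasses, §2 Remark 2.3] -/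
theorem EndAction.coe_blockCommutantEquivCorner_apply (t : S) (c : A.blockCommutant K hcent (τ t))
    (x : MatrixAlgAction.corner (ρ' t) (j₀ t)) :
    ((A.blockCommutantEquivCorner K τ hcent j₀ ρ' hρ' t c x : MatrixAlgAction.corner (ρ' t) (j₀ t)) :
        A.eigenspaceBaseChange K (τ t)) = (c : A.BlockEnd K (τ t)) x :=
  rfl

omit [Module.Finite ℚ V] in
include hτ hcard in
/-- **Milne's "`C(A) ⊗_k k^al = ∏ C_σ`, `C_σ ≈ End_Ē(V̄)`" fully split: `C(H)(K) ≃ₐ[K] ∏ₜ End_K(e V_{K,τₜ})`**, `c ↦ (c|eV_{K,τₜ})ₜ`,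
given splittings `ρₜ` of ALL blocks (`Motives/HodgeStructureEndAlgCentralizerBlocks.centralizerBaseChangeAlgEquivBlocks` then
`blockCommutantEquivCorner` blockwise). [cite: Milne1999LefschetzClasses, §2 p. 651 L64–L70 ("C(A) ⊗_k k^al = ∏ C_σ where C_σ ≈ End_Ē(V̄) ≈ M_{g/df}(k^al) × M_{g/df}(k^al)")] -/
def EndAction.centralizerBaseChangeAlgEquivCornerBlocks :
    Subalgebra.centralizer K ((fun a : Module.End ℚ V => a.baseChange K) '' (H.endAlg : Set (Module.End ℚ V))) ≃ₐ[K]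
      ∀ t : S, Module.End K (MatrixAlgAction.corner (ρ' t) (j₀ t)) :=
  (A.centralizerBaseChangeAlgEquivBlocks K τ hτ hcard hcent).trans
    (AlgEquiv.piCongrRight fun t => A.blockCommutantEquivCorner K τ hcent j₀ ρ' hρ' t)

omit [Module.Finite ℚ V] in
include hτ hcard in
/-- `(((equiv c) t) x : K ⊗ V) = c x` for `x ∈ eV_{K,τₜ}`. [cite: Milne1999LefschetzClasses, §2 p. 651 L64–L70] -/
theorem EndAction.coe_centralizerBaseChangeAlgEquivCornerBlocks_apply
    (c : Subalgebra.centralizer K ((fun a : Module.End ℚ V => a.baseChange K) '' (H.endAlg : Set (Module.End ℚ V))))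
    (t : S) (x : MatrixAlgAction.corner (ρ' t) (j₀ t)) :
    (((A.centralizerBaseChangeAlgEquivCornerBlocks K τ hτ hcard hcent j₀ ρ' hρ' c t x : MatrixAlgAction.corner (ρ' t) (j₀ t)) :
        A.eigenspaceBaseChange K (τ t)) : K ⊗[ℚ] V) = (c : Module.End K (K ⊗[ℚ] V)) x :=
  rfl

include hτ hcard hcent in
/-- **Over an algebraically closed `K`, outright: `C(H)(K) ≃ₐ[K] ∏ₜ M_m(K)`, `m = dim_ℚ V/[F:ℚ]/d`, `d²·[F:ℚ] = dim_ℚ E_φ`**, for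
`E_φ` simple with centre exactly the central `ι(F)` — "`C(A) ⊗_k k^al = ∏_σ C_σ`, `C_σ ≈ M_{g/df}(k^al) × M_{g/df}(k^al)`" (one
matrix factor for each of the `[F:ℚ] = 2f` blocks; the splittings from FILE 1, a basis of each corner).
[cite: Milne1999LefschetzClasses, §2 p. 651 L64–L70] -/
theorem exists_centralizer_baseChange_algEquiv_pi_matrix [IsAlgClosed K] [IsSimpleRing H.endAlg]
    (hcen : ∀ z ∈ H.endAlg, (∀ a ∈ H.endAlg, a * z = z * a) → z ∈ Set.range A.ι) :
    ∃ d : ℕ, NeZero d ∧ d ^ 2 * finrank ℚ F = finrank ℚ H.endAlg ∧ d ∣ finrank ℚ V / finrank ℚ F ∧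
      Nonempty (Subalgebra.centralizer K ((fun a : Module.End ℚ V => a.baseChange K) '' (H.endAlg : Set (Module.End ℚ V)))
        ≃ₐ[K] ∀ _t : S, Matrix (Fin (finrank ℚ V / finrank ℚ F / d)) (Fin (finrank ℚ V / finrank ℚ F / d)) K) := by
  classical
  obtain ⟨t₀⟩ : Nonempty S := Fintype.card_pos_iff.1 (hcard ▸ Module.finrank_pos)
  choose dρ hdρ hdimρ ρ hρ using fun t : S => A.exists_matrixAlgHom_span_blockOp_eq_range K hcent hcen (τ t)
  have hdeq : ∀ t, dρ t = dρ t₀ := fun t =>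
    Nat.pow_left_injective two_ne_zero (Nat.eq_of_mul_eq_mul_right Module.finrank_pos ((hdimρ t).trans (hdimρ _).symm))
  have hcnt : ∀ t : S,
      dρ t * finrank K (MatrixAlgAction.corner (ρ t) (0 : Fin (dρ t))) = finrank ℚ V / finrank ℚ F := fun t => by
    have h := (card_mul_finrank_corner (ρ t) (0 : Fin (dρ t))).trans (A.finrank_eigenspaceBaseChange_eq_div K τ hτ hcard t)
    rwa [Fintype.card_fin] at h
  refine ⟨dρ t₀, hdρ _, hdimρ _, Dvd.intro _ (hcnt t₀), ⟨?_⟩⟩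
  refine (A.centralizerBaseChangeAlgEquivCornerBlocks K τ hτ hcard hcent (fun t => (0 : Fin (dρ t))) ρ hρ).trans
    (AlgEquiv.piCongrRight fun t => LinearMap.toMatrixAlgEquiv (Module.finBasisOfFinrankEq K _ ?_))
  refine (Nat.div_eq_of_eq_mul_left (Nat.pos_of_ne_zero (hdρ t₀).out) ?_).symm
  calc finrank ℚ V / finrank ℚ F = dρ t * finrank K (MatrixAlgAction.corner (ρ t) (0 : Fin (dρ t))) := (hcnt t).symm
    _ = finrank K (MatrixAlgAction.corner (ρ t) (0 : Fin (dρ t))) * dρ t := mul_comm _ _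
    _ = finrank K (MatrixAlgAction.corner (ρ t) (0 : Fin (dρ t))) * dρ t₀ :=
        congrArg (finrank K (MatrixAlgAction.corner (ρ t) (0 : Fin (dρ t))) * ·) (hdeq t)

end Centralizer

end Splitting

end HodgeStructure

end Literature.AlgebraicGeometry.Motives
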